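/-
Origin: expansion seat `prover-pub-hodgecm-mc-carch-1-g5-0`, handover #CA54 2026-08-20T12:03:16Z md5 4f7307a9e89a (246 l., 8 decls; NEW additive leaf; imports RUN-50 period #P50b Model.ArchSideOfTwist34 + #CA51 Model.ArchKTypeOfLambdaConj + RUN-49 #CA49 + RUN-45 #CA34; RUN 51; drops ⇒ {#CA55, #CA57}; cert certs/ax-ArchKTypeOfLineR2-4f7307a9e89a.log: rc 0 / 40 s / 0 warnings / trio) (`HOME/mc/pub-hodgecm-mc-carch-1/pkg51/HodgeCM/Model/ArchKTypeOfLineR2.lean`, md5 4f7307a9e89a, 246 lines);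
landed by the gen-20 packager (p-g20) in gate run 51 as `HodgeCM/Model/ArchKTypeOfLineR2.lean` (verbatim).
-/
/-
Copyright (c) 2026. Released under Apache 2.0 license as described in the file LICENSE.
Cell pub-hodgecm, MODEL layer (construction prover mc-carch-1, gen 5), BINDER-OWNERS rows 12 / 17, pin R2 (lines 2, 3 of the conjugated plane):
the (c5)₂/(c5)₃ and (χ)₂/(χ)₃ inputs of the k = 2, 3 At-terms DISCHARGED at period-1's ν′-twisted split `etaT₂/etaT₃` — the twin of #CA33 § 5 + #CA34.
-/
import Summits.HodgeConjecture.HodgeCM.Model.ArchSideOfTwist34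
import Summits.HodgeConjecture.HodgeCM.Model.ArchKTypeOfLineTables34
import Summits.HodgeConjecture.HodgeCM.Model.ArchKTypeOfLambdaConj
import Summits.HodgeConjecture.HodgeCM.Model.ArchKTypeOfLineSection

/-!
# Pin R2: the definite-place and `v₁` inputs of lines 2, 3 at `η₂ := etaT₂ η ν′`, `η₃ := etaT₃ η ν′`

period-1 #P50b `ArchSideOfTwist34` answers carch's design finding (R2): the conjugated lines carry a SECOND `U(V)(𝔸)`-twist `ν′`,
`etaT₂ V S η ν′ = (ν′⁻¹ ∘ fst) · eta₂ V S η`, `etaT₃ V S η ν′ = (ν′ ∘ fst) · eta₃ V S η` (`etaT₃_apply_mk_one : etaT₃ … (x,1) = ν′ x`,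
`etaT₂_apply_mk_one : etaT₂ … (x,1) = (ν′ x)⁻¹ · η(x,1)`).  With E's `η := EtaChi.η χV χW` and `ν′ := νOf ν₃` (#CA33's bare-hom reading of a
unitary character `ν₃`), this leaf discharges the four inputs of carch's k = 2, 3 At-terms (#CA43/#CA47 `archKTypeOfSlotTwo/ThreeAt(Coset)G`,
dischargers #CA44 `harch_two/three_of_defType(_coset)G`) from TYPE facts only:

* § 1 `etaT₃_archSingle_one`, `etaT₂_archSingle_one` — the η-parts on one-place elements (`det^{n₃}`, `det^{nV − n₃}`);
* § 2 **`hdef_three_R2 (hn₃)`** — the `hdef` input of #CA44 `harch_three_…` at `a := defExponentThree` for `ν₃` of type `n₃R` (#CA49; via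
  `archScalar_threeG_archSingle_eq`); **`hdef_two_R2 (hnV) (hn₃) (hSig)`** — the `hdef` input of `harch_two_…` at `a := defExponentTwo` for `χV` of type
  `nVR` (the SHARED R1 character), `ν₃` of type `n₃R`, GIVEN the R1/R2 consistency `hSig : nVR (w b) = nVR₂ (w b)` off `v₁` (#CA50/`…SigmaConjHolds`),
  through #CA48 `hdef_two_of_archType`;
* § 3 `etaT₃/etaT₂_archSectionFrameOf_one` (under `(mk ι₁).embedding = ι₁`, #CA34 `eta_archSectionFrameOf_one`);
* § 4 **`hχ_three_R2 (hemb) (hn₃)`** — the `hχ` input of the k = 3 At-term (#CA3 `lineScalar_three`, #CA11 `lineScalar_identity_of_exponents`,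
  `e_P − e_Q = 1`); **`hχ_two_R2 (hemb) (hnV) (hn₃) (hSig₁)`** — the `hχ` input of the k = 2 At-term through #CA51 `hχ_two_of_archType`, GIVEN the
  R1/R2 consistency at `v₁` `hSig₁ : nVR (mk ι₁) = −eP² − eP³ − lambdaExponentConj` (#CA52/`…SigmaConjHolds`).

The consistency facts `hSig`, `hSig₁` are THEOREMS (`ArchKTypeOfSigmaConjHolds.nVR_eq_nVR₂`, `….nVR_mk_eq_conj`); they are kept as hypotheses here so
that this leaf depends on #P50b alone among the RUN-50 rows.  0 records, 0 `def … : Prop`, nothing cited as a hypothesis.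
-/

set_option autoImplicit false

noncomputable section

open NumberField NumberField.InfinitePlace NumberField.mixedEmbedding IsDedekindDomain
open scoped Matrix Classical
open ComplexConjugate
open Literature.Geometry.ComplexHyperbolic Literature.Geometry.ComplexHyperbolic.BallModel
open Literature.NumberTheory.Automorphic Literature.NumberTheory.Automorphic.UnitaryGroup Literature.NumberTheory.Automorphic.U21
open Literature.NumberTheory.Weil1964
open Literature.NumberTheory.GelbartRogawski1991 Literature.NumberTheory.GelbartRogawski1991.UnitaryDualPair
open Literature.RepresentationTheory.KonnoKonno2007
open HodgeCM.Adelic HodgeCM.PerL34 HodgeCM.Model.HypCensus HodgeCM.Model.ArchSideTerm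

namespace HodgeCM.Model

/-! ## § 1 The η-parts of the R2 split on one-place elements -/

section OnePlace

variable
  (χV χW ν₃ : ∀ {L : CMField} {ι₁ : L →+* ℂ} (_V : HermSpace3 L ι₁) (_c : SeesawCtx L),
    ContinuousMonoidHom (Literature.NumberTheory.Automorphic.relNormOneIdeles (↥(NumberField.maximalRealSubfield (L : Type))) (L : Type) ⧸
      Literature.NumberTheory.Automorphic.relNormOneRat (↥(NumberField.maximalRealSubfield (L : Type))) (L : Type)) Circle)
variable {L : CMField} {ι₁ : L →+* ℂ} (V : HermSpace3 L ι₁) (c : SeesawCtx L)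

/-- the η₃-part of the R2 line-3 scalar on a one-place element: `det(u)^{n₃ (w)}`. -/
theorem etaT₃_archSingle_one {n₃ : InfinitePlace (L : Type) → ℤ} (hn₃ : UnitaryLineChar.HasArchType (L : Type) (ν₃ V c) n₃)
    (w₀ : {w : InfinitePlace (L : Type) // w.IsComplex}) (u : archLocal (L : Type) 3 (Matrix.diagonal (frameD V)) w₀) :
    ((etaT₃ V c.D (EtaChi.η @χV @χW V c) (νOf @ν₃ V c)
        (UnitaryGroup.archToAdelic (↥(maximalRealSubfield L)) L (IsCMField.complexConj L) 3 (Matrix.diagonal (frameD V))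
          (UnitaryGroup.archSingle (↥(maximalRealSubfield L)) L (IsCMField.complexConj L) 3 (Matrix.diagonal (frameD V))
            (IsCMField.complexConj_ne_one L) (UnitaryGroup.complexConj_smul_infinitePlace (L : Type)) w₀ u), 1) : ℂˣ) : ℂ) =
      (((u : archLocal (L : Type) 3 (Matrix.diagonal (frameD V)) w₀) : GL (Fin 3) ℂ) : Matrix (Fin 3) (Fin 3) ℂ).det ^ n₃ w₀.1 := by
  rw [etaT₃_apply_mk_one, νOf_archSingle @ν₃ V c hn₃]

/-- the η₂-part of the R2 line-2 scalar on a one-place element: `det(u)^{nV (w) − n₃ (w)}`. -/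
theorem etaT₂_archSingle_one {nV n₃ : InfinitePlace (L : Type) → ℤ} (hnV : UnitaryLineChar.HasArchType (L : Type) (χV V c) nV)
    (hn₃ : UnitaryLineChar.HasArchType (L : Type) (ν₃ V c) n₃)
    (w₀ : {w : InfinitePlace (L : Type) // w.IsComplex}) (u : archLocal (L : Type) 3 (Matrix.diagonal (frameD V)) w₀) :
    ((etaT₂ V c.D (EtaChi.η @χV @χW V c) (νOf @ν₃ V c)
        (UnitaryGroup.archToAdelic (↥(maximalRealSubfield L)) L (IsCMField.complexConj L) 3 (Matrix.diagonal (frameD V))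
          (UnitaryGroup.archSingle (↥(maximalRealSubfield L)) L (IsCMField.complexConj L) 3 (Matrix.diagonal (frameD V))
            (IsCMField.complexConj_ne_one L) (UnitaryGroup.complexConj_smul_infinitePlace (L : Type)) w₀ u), 1) : ℂˣ) : ℂ) =
      (((u : archLocal (L : Type) 3 (Matrix.diagonal (frameD V)) w₀) : GL (Fin 3) ℂ) : Matrix (Fin 3) (Fin 3) ℂ).det ^ (nV w₀.1 - n₃ w₀.1) := by
  rw [etaT₂_apply_mk_one, Units.val_mul, Units.val_inv_eq_inv_val, νOf_archSingle @ν₃ V c hn₃, eta_archSingle_one @χV @χW V c hnV,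
    ← zpow_neg, ← zpow_add₀ (det_archLocal_ne_zero V u)]
  congr 1
  ring

end OnePlace

/-! ## § 2 The definite-place inputs (c5)₃ / (c5)₂ at pin R2 -/

section R2Definite

variable
  (χV χW ν₃ : ∀ {L : CMField} {ι₁ : L →+* ℂ} (_V : HermSpace3 L ι₁) (_c : SeesawCtx L),
    ContinuousMonoidHom (Literature.NumberTheory.Automorphic.relNormOneIdeles (↥(NumberField.maximalRealSubfield (L : Type))) (L : Type) ⧸
      Literature.NumberTheory.Automorphic.relNormOneRat (↥(NumberField.maximalRealSubfield (L : Type))) (L : Type)) Circle)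
variable {L : CMField} {ι₁ : L →+* ℂ} (V : HermSpace3 L ι₁) (c : SeesawCtx L)
variable
  (hGR : (cmSplittingDatum (L : Type) finProdFinEquiv (frameD V) (frameD_real V) (frameD_ne V) (dW c.D) (dW_real c.D) (dW_ne c.D)).CompatibleSplitting)
  (hGR₀ : (cmSplittingDatum (L : Type) (e₁) (frameD V) (frameD_real V) (frameD_ne V) (lineVec (L : Type) (dW c.D 0))
    (fun _ => dW_real c.D 0) (fun _ => dW_ne c.D 0)).CompatibleSplitting)
  (hGR₁ : (cmSplittingDatum (L : Type) (e₁) (frameD V) (frameD_real V) (frameD_ne V) (lineVec (L : Type) (dW c.D 1))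
    (fun _ => dW_real c.D 1) (fun _ => dW_ne c.D 1)).CompatibleSplitting)
  (hGR₂ : (cmSplittingDatum (L : Type) (e₁) (frameD V) (frameD_real V) (frameD_ne V) (lineVec (L : Type) (dW' c.D 0))
    (fun _ => dW'_real c.D 0) (fun _ => dW'_ne c.D 0)).CompatibleSplitting)
  (hGR₃ : (cmSplittingDatum (L : Type) (e₁) (frameD V) (frameD_real V) (frameD_ne V) (lineVec (L : Type) (dW' c.D 1))
    (fun _ => dW'_real c.D 1) (fun _ => dW'_ne c.D 1)).CompatibleSplitting)
  (h₁W : (∀ j, 0 < (ι₁ (dW c.D j)).re) ∨ ∀ j, (ι₁ (dW c.D j)).re < 0)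
  (hpos₀ : 0 < cmXW (L : Type) (frameD V) (lineVec (L : Type) (dW c.D 0)) (fun _ => dW_real c.D 0) ι₁ (HypCensus.cmPlace (L : Type) ι₁) 0)
  (hpos₁ : 0 < cmXW (L : Type) (frameD V) (lineVec (L : Type) (dW c.D 1)) (fun _ => dW_real c.D 1) ι₁ (HypCensus.cmPlace (L : Type) ι₁) 0)
  (hpos₂ : 0 < cmXW (L : Type) (frameD V) (lineVec (L : Type) (dW' c.D 0)) (fun _ => dW'_real c.D 0) ι₁ (HypCensus.cmPlace (L : Type) ι₁) 0)
  (hpos₃ : 0 < cmXW (L : Type) (frameD V) (lineVec (L : Type) (dW' c.D 1)) (fun _ => dW'_real c.D 1) ι₁ (HypCensus.cmPlace (L : Type) ι₁) 0)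
variable (hnV : UnitaryLineChar.HasArchType (L : Type) (χV V c) (nVR V c hGR hGR₀ hGR₁ h₁W hpos₀ hpos₁))
  (hn₃ : UnitaryLineChar.HasArchType (L : Type) (ν₃ V c) (n₃R V c hGR₃ hpos₃))

include hn₃ in
/-- **(c5)₃ AT PIN R2: the `hdef` hypothesis of #CA44 `harch_three_of_defType(_coset)G` HOLDS** for `η₃ := etaT₃ … (EtaChi.η χV χW V c) (νOf ν₃ V c)`,
`a := defExponentThree` and `ν₃` of type `n₃R`. -/
theorem hdef_three_R2 :
    ∀ b : {v : InfinitePlace ↥(maximalRealSubfield L) // v.IsReal}, b ≠ HypCensus.cmPlace (L : Type) ι₁ →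
      ∀ u : UnitaryGroup.archLocal (L : Type) 3 (Matrix.diagonal (frameD V)) (cmPlaceOver (L : Type) b),
        ((archScalar_threeG V c.D hGR hGR₂ hGR₃ (etaT₃ V c.D (EtaChi.η @χV @χW V c) (νOf @ν₃ V c))
            (UnitaryGroup.archSingle (↥(maximalRealSubfield L)) L (IsCMField.complexConj L) 3 (Matrix.diagonal (frameD V))
            (IsCMField.complexConj_ne_one L) (UnitaryGroup.complexConj_smul_infinitePlace (L : Type)) (cmPlaceOver (L : Type) b) u) : ℂˣ) : ℂ) *
          (((u : archLocal (L : Type) 3 (Matrix.diagonal (frameD V)) (cmPlaceOver (L : Type) b)) : GL (Fin 3) ℂ) : Matrix (Fin 3) (Fin 3) ℂ).det ^ defExponentThree V c hGR₃ hpos₃ b = 1 := by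
  intro b hb u
  rw [archScalar_threeG_archSingle_eq, etaT₃_archSingle_one @χV @χW @ν₃ V c hn₃, n₃R_of_ne V c hGR₃ hpos₃ hb,
    ← zpow_add₀ (det_archLocal_ne_zero V u), neg_add_cancel, zpow_zero]

include hnV hn₃ in
/-- **(c5)₂ AT PIN R2: the `hdef` hypothesis of #CA44 `harch_two_of_defType(_coset)G` HOLDS** for `η₂ := etaT₂ … (EtaChi.η χV χW V c) (νOf ν₃ V c)`,
`a := defExponentTwo`, the SHARED `χV` of type `nVR`, `ν₃` of type `n₃R`, GIVEN the R1/R2 consistency `nVR = nVR₂` off `v₁`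
(the conjugated see-saw factor absorbed by `ℓ′_b` through #CA48). -/
theorem hdef_two_R2
    (hSig : ∀ b : {v : InfinitePlace ↥(maximalRealSubfield L) // v.IsReal}, b ≠ HypCensus.cmPlace (L : Type) ι₁ →
      nVR V c hGR hGR₀ hGR₁ h₁W hpos₀ hpos₁ (cmPlaceOver (L : Type) b).1 = nVR₂ V c hGR hGR₂ hGR₃ h₁W hpos₂ hpos₃ (cmPlaceOver (L : Type) b).1) :
    ∀ b : {v : InfinitePlace ↥(maximalRealSubfield L) // v.IsReal}, b ≠ HypCensus.cmPlace (L : Type) ι₁ →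
      ∀ u : UnitaryGroup.archLocal (L : Type) 3 (Matrix.diagonal (frameD V)) (cmPlaceOver (L : Type) b),
        ((archScalar_twoG V c.D hGR hGR₂ hGR₃ (etaT₂ V c.D (EtaChi.η @χV @χW V c) (νOf @ν₃ V c))
            (UnitaryGroup.archSingle (↥(maximalRealSubfield L)) L (IsCMField.complexConj L) 3 (Matrix.diagonal (frameD V))
            (IsCMField.complexConj_ne_one L) (UnitaryGroup.complexConj_smul_infinitePlace (L : Type)) (cmPlaceOver (L : Type) b) u) : ℂˣ) : ℂ) *
          (((u : archLocal (L : Type) 3 (Matrix.diagonal (frameD V)) (cmPlaceOver (L : Type) b)) : GL (Fin 3) ℂ) : Matrix (Fin 3) (Fin 3) ℂ).det ^ defExponentTwo V c hGR₂ hpos₂ b = 1 :=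
  hdef_two_of_archType V c.D hGR hGR₂ hGR₃ (etaT₂ V c.D (EtaChi.η @χV @χW V c) (νOf @ν₃ V c)) h₁W (defExponentTwo V c hGR₂ hpos₂)
    (fun b => nVR V c hGR hGR₀ hGR₁ h₁W hpos₀ hpos₁ (cmPlaceOver (L : Type) b).1 - n₃R V c hGR₃ hpos₃ (cmPlaceOver (L : Type) b).1)
    (fun b _ u => etaT₂_archSingle_one @χV @χW @ν₃ V c hnV hn₃ (cmPlaceOver (L : Type) b) u)
    (fun b hb => by rw [hSig b hb, nVR₂_of_ne V c hGR hGR₂ hGR₃ h₁W hpos₂ hpos₃ hb, n₃R_of_ne V c hGR₃ hpos₃ hb]; ring)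

end R2Definite

/-! ## § 3 The η-parts of the R2 split on the `ι₁`-section -/

section Section

variable
  (χV χW ν₃ : ∀ {L : CMField} {ι₁ : L →+* ℂ} (_V : HermSpace3 L ι₁) (_c : SeesawCtx L),
    ContinuousMonoidHom (Literature.NumberTheory.Automorphic.relNormOneIdeles (↥(NumberField.maximalRealSubfield (L : Type))) (L : Type) ⧸
      Literature.NumberTheory.Automorphic.relNormOneRat (↥(NumberField.maximalRealSubfield (L : Type))) (L : Type)) Circle)
variable {L : CMField} {ι₁ : L →+* ℂ} (V : HermSpace3 L ι₁) (c : SeesawCtx L)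
variable (hemb : (InfinitePlace.mk ι₁).embedding = ι₁)

include hemb in
/-- `η₃'((archSectionFrameOf V u)^𝔸, 1) = (det u)^{n₃ (mk ι₁)}`. -/
theorem etaT₃_archSectionFrameOf_one {n₃ : InfinitePlace (L : Type) → ℤ} (hn₃ : UnitaryLineChar.HasArchType (L : Type) (ν₃ V c) n₃) (u : U21) :
    ((etaT₃ V c.D (EtaChi.η @χV @χW V c) (νOf @ν₃ V c)
        (UnitaryGroup.archToAdelic (↥(maximalRealSubfield L)) L (IsCMField.complexConj L) 3 (Matrix.diagonal (frameD V))
          (archSectionFrameOf V u), 1) : ℂˣ) : ℂ) = (mat u).det ^ n₃ (InfinitePlace.mk ι₁) := by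
  rw [etaT₃_apply_mk_one, νOf_archSectionFrameOf @ν₃ V c hemb hn₃]

include hemb in
/-- `η₂'((archSectionFrameOf V u)^𝔸, 1) = (det u)^{nV (mk ι₁) − n₃ (mk ι₁)}`. -/
theorem etaT₂_archSectionFrameOf_one {nV n₃ : InfinitePlace (L : Type) → ℤ} (hnV : UnitaryLineChar.HasArchType (L : Type) (χV V c) nV)
    (hn₃ : UnitaryLineChar.HasArchType (L : Type) (ν₃ V c) n₃) (u : U21) :
    ((etaT₂ V c.D (EtaChi.η @χV @χW V c) (νOf @ν₃ V c)
        (UnitaryGroup.archToAdelic (↥(maximalRealSubfield L)) L (IsCMField.complexConj L) 3 (Matrix.diagonal (frameD V))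
          (archSectionFrameOf V u), 1) : ℂˣ) : ℂ) = (mat u).det ^ (nV (InfinitePlace.mk ι₁) - n₃ (InfinitePlace.mk ι₁)) := by
  rw [etaT₂_apply_mk_one, Units.val_mul, Units.val_inv_eq_inv_val, νOf_archSectionFrameOf @ν₃ V c hemb hn₃,
    eta_archSectionFrameOf_one @χV @χW V c hemb hnV, ← zpow_neg, ← zpow_add₀ (det_mat_ne_zero u)]
  congr 1
  ring

end Section

/-! ## § 4 The `v₁` inputs (χ)₃ / (χ)₂ at pin R2 -/

section Chi

variable
  (χV χW ν₃ : ∀ {L : CMField} {ι₁ : L →+* ℂ} (_V : HermSpace3 L ι₁) (_c : SeesawCtx L),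
    ContinuousMonoidHom (Literature.NumberTheory.Automorphic.relNormOneIdeles (↥(NumberField.maximalRealSubfield (L : Type))) (L : Type) ⧸
      Literature.NumberTheory.Automorphic.relNormOneRat (↥(NumberField.maximalRealSubfield (L : Type))) (L : Type)) Circle)
variable {L : CMField} {ι₁ : L →+* ℂ} (V : HermSpace3 L ι₁) (c : SeesawCtx L)
variable
  (hGR : (cmSplittingDatum (L : Type) finProdFinEquiv (frameD V) (frameD_real V) (frameD_ne V) (dW c.D) (dW_real c.D) (dW_ne c.D)).CompatibleSplitting)
  (hGR₀ : (cmSplittingDatum (L : Type) (e₁) (frameD V) (frameD_real V) (frameD_ne V) (lineVec (L : Type) (dW c.D 0))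
    (fun _ => dW_real c.D 0) (fun _ => dW_ne c.D 0)).CompatibleSplitting)
  (hGR₁ : (cmSplittingDatum (L : Type) (e₁) (frameD V) (frameD_real V) (frameD_ne V) (lineVec (L : Type) (dW c.D 1))
    (fun _ => dW_real c.D 1) (fun _ => dW_ne c.D 1)).CompatibleSplitting)
  (hGR₂ : (cmSplittingDatum (L : Type) (e₁) (frameD V) (frameD_real V) (frameD_ne V) (lineVec (L : Type) (dW' c.D 0))
    (fun _ => dW'_real c.D 0) (fun _ => dW'_ne c.D 0)).CompatibleSplitting)
  (hGR₃ : (cmSplittingDatum (L : Type) (e₁) (frameD V) (frameD_real V) (frameD_ne V) (lineVec (L : Type) (dW' c.D 1))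
    (fun _ => dW'_real c.D 1) (fun _ => dW'_ne c.D 1)).CompatibleSplitting)
  (h₁W : (∀ j, 0 < (ι₁ (dW c.D j)).re) ∨ ∀ j, (ι₁ (dW c.D j)).re < 0)
  (hpos₀ : 0 < cmXW (L : Type) (frameD V) (lineVec (L : Type) (dW c.D 0)) (fun _ => dW_real c.D 0) ι₁ (HypCensus.cmPlace (L : Type) ι₁) 0)
  (hpos₁ : 0 < cmXW (L : Type) (frameD V) (lineVec (L : Type) (dW c.D 1)) (fun _ => dW_real c.D 1) ι₁ (HypCensus.cmPlace (L : Type) ι₁) 0)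
  (hpos₂ : 0 < cmXW (L : Type) (frameD V) (lineVec (L : Type) (dW' c.D 0)) (fun _ => dW'_real c.D 0) ι₁ (HypCensus.cmPlace (L : Type) ι₁) 0)
  (hpos₃ : 0 < cmXW (L : Type) (frameD V) (lineVec (L : Type) (dW' c.D 1)) (fun _ => dW'_real c.D 1) ι₁ (HypCensus.cmPlace (L : Type) ι₁) 0)
variable (hemb : (InfinitePlace.mk ι₁).embedding = ι₁)
  (hnV : UnitaryLineChar.HasArchType (L : Type) (χV V c) (nVR V c hGR hGR₀ hGR₁ h₁W hpos₀ hpos₁))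
  (hn₃ : UnitaryLineChar.HasArchType (L : Type) (ν₃ V c) (n₃R V c hGR₃ hpos₃))

include hemb hn₃ in
/-- **(χ)₃ AT PIN R2: the `hχ` input of the k = 3 At-terms (#CA43/#CA47) HOLDS** for `η₃ := etaT₃ … (EtaChi.η χV χW V c) (νOf ν₃ V c)` and `ν₃` of type
`n₃R` — the line-3 scalar on the section IS `ν′`, of type `−eP³` at `w(ι₁)`, and `e_P − e_Q = 1`. -/
theorem hχ_three_R2 (u : MulAction.stabilizer U21 x₀) :
    ((lineScalar_three V c.D hGR hGR₂ hGR₃ (etaT₃ V c.D (EtaChi.η @χV @χW V c) (νOf @ν₃ V c)) (u : U21) : ℂˣ) : ℂ) *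
        ((matA (stabilizerEquivK21.symm u)).det ^ (lineVacExponentsThree V c hGR₃ (posIdxEquivUnit hpos₃) (negIdxEquivEmpty hpos₃)).eP *
          sclD (stabilizerEquivK21.symm u) ^ (lineVacExponentsThree V c hGR₃ (posIdxEquivUnit hpos₃) (negIdxEquivEmpty hpos₃)).eQ) =
      star (sclD (stabilizerEquivK21.symm u)) := by
  have hd := lineVacExponentsThree_eP_sub_eQ V c hGR₃ (posIdxEquivUnit hpos₃) (negIdxEquivEmpty hpos₃)
  refine lineScalar_identity_of_exponents (χ := lineScalar_three V c.D hGR hGR₂ hGR₃ (etaT₃ V c.D (EtaChi.η @χV @χW V c) (νOf @ν₃ V c)))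
    (m := -(lineVacExponentsThree V c hGR₃ (posIdxEquivUnit hpos₃) (negIdxEquivEmpty hpos₃)).eP) (m' := -(lineVacExponentsThree V c hGR₃ (posIdxEquivUnit hpos₃) (negIdxEquivEmpty hpos₃)).eP) (fun u => ?_) (by omega) (by omega) u
  rw [lineScalar_three_apply, cmConjLineChar₁_apply_mk_one, mul_one, etaT₃_archSectionFrameOf_one @χV @χW @ν₃ V c hemb hn₃, n₃R_mk,
    det_mat_stabilizer, mul_zpow]

include hemb hnV hn₃ in
/-- **(χ)₂ AT PIN R2: the `hχ` input of the k = 2 At-terms (#CA43/#CA47) HOLDS** for `η₂ := etaT₂ … (EtaChi.η χV χW V c) (νOf ν₃ V c)`, the SHARED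
`χV` of type `nVR`, `ν₃` of type `n₃R`, GIVEN the R1/R2 consistency at `v₁` `hSig₁ : nVR (mk ι₁) = −eP² − eP³ − ℓ″` (the conjugated see-saw factor
absorbed by `ℓ″ = lambdaExponentConj` through #CA51). -/
theorem hχ_two_R2
    (hSig₁ : nVR V c hGR hGR₀ hGR₁ h₁W hpos₀ hpos₁ (InfinitePlace.mk ι₁) =
      -(lineVacExponentsTwo V c hGR₂ (posIdxEquivUnit hpos₂) (negIdxEquivEmpty hpos₂)).eP - (lineVacExponentsThree V c hGR₃ (posIdxEquivUnit hpos₃) (negIdxEquivEmpty hpos₃)).eP - lambdaExponentConj V c.D hGR hGR₂ hGR₃ h₁W)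
    (u : MulAction.stabilizer U21 x₀) :
    ((lineScalar_two V c.D hGR hGR₂ hGR₃ (etaT₂ V c.D (EtaChi.η @χV @χW V c) (νOf @ν₃ V c)) (u : U21) : ℂˣ) : ℂ) *
        ((matA (stabilizerEquivK21.symm u)).det ^ (lineVacExponentsTwo V c hGR₂ (posIdxEquivUnit hpos₂) (negIdxEquivEmpty hpos₂)).eP *
          sclD (stabilizerEquivK21.symm u) ^ (lineVacExponentsTwo V c hGR₂ (posIdxEquivUnit hpos₂) (negIdxEquivEmpty hpos₂)).eQ) =
      star (sclD (stabilizerEquivK21.symm u)) := by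
  have hd := lineVacExponentsTwo_eP_sub_eQ V c hGR₂ (posIdxEquivUnit hpos₂) (negIdxEquivEmpty hpos₂)
  refine hχ_two_of_archType V c.D hGR hGR₂ hGR₃ (etaT₂ V c.D (EtaChi.η @χV @χW V c) (νOf @ν₃ V c)) h₁W
    (m := nVR V c hGR hGR₀ hGR₁ h₁W hpos₀ hpos₁ (InfinitePlace.mk ι₁) - n₃R V c hGR₃ hpos₃ (InfinitePlace.mk ι₁))
    (lineVacExponentsTwo V c hGR₂ (posIdxEquivUnit hpos₂) (negIdxEquivEmpty hpos₂)) (fun u => ?_) ?_ ?_ u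
  · rw [etaT₂_archSectionFrameOf_one @χV @χW @ν₃ V c hemb hnV hn₃, det_mat_stabilizer]
  · rw [hSig₁, n₃R_mk]; ring
  · rw [hSig₁, n₃R_mk]; omega

end Chi

end HodgeCM.Model

end
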